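import Summits.ValiantsHypothesis.ValiantsHypothesis.Theorems.DepthWindowDial
import Summits.ValiantsHypothesis.ValiantsHypothesis.Theorems.DepthWindowGrowing
import HarnessLib

/-!
# Route `DepthWindow` — the window certificate after the growing-depth rung

Companion of `DepthWindowDial.lean` (generation 2: the dial `A_Δ` / `B_Δ`, `B_Δ ↔ (A_Δ → VH)`, brackets
`B_{Δ₀} ↔ VH` for constant `Δ₀` and `A_{⌈log₂ n⌉+1} ↔ VH`) and `DepthWindowGrowing.lean` (generation 3: the kernel
rung `perHardGrowingDepth` = `A_{⌊L₃ n⌋/3}`, `L₃ n := ⌊log₂⌊log₂⌊log₂ n⌋⌋⌋`).  Decomp-valiant workshop, lens 4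
«depth-reduction / chasm axis», generation 3; authored by the lens seat; node record `NODE-v3.md` in
`run/shared/lean/pub/decomp-valiant/decomp-val-lens-4/`.

* `collapseToDepth_growing_iff_vh` : the BOTTOM BRACKET MOVES UP to an unbounded depth — at product-depth `⌊L₃ n⌋/3`
  the residual template `B_Δ` IS the summit (`B_{⌊L₃/3⌋} ↔ VH`), because its partner `A_{⌊L₃/3⌋}` is now a theorem.
* `window_certificate_growing` : the node's pieces (`PerHardLog3` = `A_{L₃+1}`, `CollapseLog3` = `B_{L₃+1}`) sit between
  the two kernel identities `B_{⌊L₃/3⌋} ↔ VH` (below) and `A_{⌈log₂ n⌉+1} ↔ VH` (above), with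
  `⌊L₃ n⌋/3 ≤ L₃ n + 1 ≤ ⌈log₂ n⌉ + 1` pointwise and the lower gap `L₃ n + 1 - ⌊L₃ n⌋/3` unbounded
  (`window_gap_unbounded`).

Unconditional, 0 sorry, def-free; it does NOT prove VP ≠ VNP and closes no item (rung currency only).
References: [LimayeSrinivasanTavenas2025] Cor. 4; [ValiantSkyumBerkowitzRackoff1983]; [Burgisser2000TCS] §2.
-/

-- layout Summits/ValiantsHypothesis/ValiantsHypothesis forces the duplicated namespace component
set_option linter.dupNamespace false

namespace Summit.ValiantsHypothesis.ValiantsHypothesis.Theorems.DepthWindow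

open MvPolynomial Literature.Computability.AlgebraicComplexity ArithCircuit
open Summit.ValiantsHypothesis.ValiantsHypothesis.Theses.DepthWindow

noncomputable section

/-- **Bottom bracket at growing depth (kernel iff)**: `B_{⌊L₃/3⌋} ↔ VH` — under `VP = VNP` the permanent gets
polynomial-wire circuits of product-depth `⌊log₂⌊log₂⌊log₂ n⌋⌋⌋/3` if and only if Valiant's hypothesis holds
(from `perHardGrowingDepth` and `collapseToDepth_iff_residual`). [cite: LimayeSrinivasanTavenas2025, Cor. 4] -/
theorem collapseToDepth_growing_iff_vh :
    (VP ℂ = VNP ℂ → ∃ c : ℕ, ∀ n : ℕ, ∃ C : ArithCircuit ℂ (Fin n × Fin n),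
      C.Computes (perPoly (Fin n) ℂ) ∧ C.productDepth ≤ Nat.log 2 (Nat.log 2 (Nat.log 2 n)) / 3 ∧
        C.edgeSize ≤ n ^ c + c) ↔
    _root_.ValiantsHypothesis :=
  ⟨fun hB => (collapseToDepth_iff_residual fun n => Nat.log 2 (Nat.log 2 (Nat.log 2 n)) / 3).mp hB
      perHardGrowingDepth,
    fun h => collapseToDepth_of_vh (fun n => Nat.log 2 (Nat.log 2 (Nat.log 2 n)) / 3) h⟩

/-- The lower gap of the window is unbounded: for every `k` some `n` has `⌊L₃ n⌋/3 + k ≤ L₃ n + 1`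
(take the tower `n = 2^(2^(2^(3k)))`, where `L₃ n = 3k` by `log3_tower`). [folklore] -/
theorem window_gap_unbounded (k : ℕ) :
    ∃ n : ℕ, Nat.log 2 (Nat.log 2 (Nat.log 2 n)) / 3 + k ≤ Nat.log 2 (Nat.log 2 (Nat.log 2 n)) + 1 := by
  refine ⟨2 ^ (2 ^ (2 ^ (3 * k))), ?_⟩
  rw [log3_tower]
  omega

/-- **The window certificate after generation 3**: below the node, `B_{⌊L₃/3⌋} ↔ VH` (growing depth, kernel);
above it, `A_{⌈log₂ n⌉+1} ↔ VH` (VSBR); and `⌊L₃ n⌋/3 ≤ L₃ n + 1 ≤ ⌈log₂ n⌉ + 1` for every `n`. [folklore] -/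
theorem window_certificate_growing :
    ((VP ℂ = VNP ℂ → ∃ c : ℕ, ∀ n : ℕ, ∃ C : ArithCircuit ℂ (Fin n × Fin n),
        C.Computes (perPoly (Fin n) ℂ) ∧ C.productDepth ≤ Nat.log 2 (Nat.log 2 (Nat.log 2 n)) / 3 ∧
          C.edgeSize ≤ n ^ c + c) ↔
      _root_.ValiantsHypothesis) ∧
    ((¬ ∃ c : ℕ, ∀ n : ℕ, ∃ C : ArithCircuit ℂ (Fin n × Fin n),
        C.Computes (perPoly (Fin n) ℂ) ∧ C.productDepth ≤ Nat.clog 2 n + 1 ∧ C.edgeSize ≤ n ^ c + c) ↔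
      _root_.ValiantsHypothesis) ∧
    (∀ n, Nat.log 2 (Nat.log 2 (Nat.log 2 n)) / 3 ≤ Nat.log 2 (Nat.log 2 (Nat.log 2 n)) + 1 ∧
      Nat.log 2 (Nat.log 2 (Nat.log 2 n)) + 1 ≤ Nat.clog 2 n + 1) :=
  ⟨collapseToDepth_growing_iff_vh, perHardAtDepth_clog_succ_iff_vh,
    fun n => ⟨by omega, log3Depth_le_clog_succ n⟩⟩

/-- The crux `PerHardLog3` (= `A_{L₃+1}`) implies the proved rung `A_{⌊L₃/3⌋}` (so the rung is the WEAKER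
statement; recorded for the node's tags — the rung itself is `perHardGrowingDepth`). [folklore] -/
theorem perHardLog3_imp_perHardGrowingDepth (hA : PerHardLog3) :
    ¬ ∃ c : ℕ, ∀ n : ℕ, ∃ C : ArithCircuit ℂ (Fin n × Fin n),
      C.Computes (perPoly (Fin n) ℂ) ∧ C.productDepth ≤ Nat.log 2 (Nat.log 2 (Nat.log 2 n)) / 3 ∧
        C.edgeSize ≤ n ^ c + c :=
  perHardAtDepth_anti (Δ := fun n => Nat.log 2 (Nat.log 2 (Nat.log 2 n)) / 3)
    (Δ' := fun n => Nat.log 2 (Nat.log 2 (Nat.log 2 n)) + 1) (fun n => by omega) hA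

end

end Summit.ValiantsHypothesis.ValiantsHypothesis.Theorems.DepthWindow
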